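import Summits.QuantumFields.QCD.Theses.SpectralDefectExtinction
import Literature.Probability.LatticeModels.LatticeGreenRiemannSum

/-!
# Stub `stub_greenBound` of line `positivity-no-leak-spread`
(crux `Summit.QuantumFields.QCD.Theses.SpectralDefectExtinction.TipNoBinding`, item stmt-QuantumFields-8965)

**The `d = 4` constant.**  The massless lattice Green function of the four-torus `(ℤ/L)⁴` at
coinciding points,

  `K_L := L⁻⁴ Σ_{k ≠ 0} 1 / ε_L(k)`,  `ε_L(k) := Σ_μ 4 sin²(π k_μ.val / L)`

(the symbol of the lattice Laplacian `Σ_μ ∇_μ† ∇_μ`), is bounded uniformly in `L`; we prove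
`K_L ≤ 4` for every `L ≥ 1` (numerically `K_L ↗ G_{ℤ⁴}(0) ≈ 0.155`).

Proof (elementary).  For `k ≠ 0` let `m_μ := ZMod.valMinAbs (k μ) ∈ (-L/2, L/2]` be the centred
representatives, `m ≠ 0`.  Since `k_μ.val ≡ m_μ (mod L)`, `4 sin²(π k_μ.val / L) = 2 (1 − cos(2π m_μ / L))`,
and Kober's/Jordan's inequality `cos x ≤ 1 − (2/π²) x²` on `|x| ≤ π` (Mathlib
`Real.cos_le_one_sub_mul_cos_sq`) gives `4 sin²(π k_μ.val / L) ≥ 16 m_μ² / L²`, whence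
`ε_L(k) ≥ (16/L²) Σ_μ m_μ² ≥ (16/L²) ‖m‖_∞²` and `1/ε_L(k) ≤ (L²/16) ‖m‖_∞⁻²`.  The map `k ↦ m` is
injective into the punctured box `{0 < ‖m‖_∞ ≤ L/2} ⊆ ℤ⁴`, so the tree's shell count
`sum_box_inv_norm_sq_le` (`Σ_{0<‖m‖_∞≤R} ‖m‖_∞⁻² ≤ 2d 3^{d-1} R^{d-2}`, here `216 (L/2)² ≤ 54 L²`) yields
`K_L ≤ L⁻⁴ · (L²/16) · 54 L² = 27/8 ≤ 4`.  This is the only place on the line where `d = 4 > 2` enters.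

Pure theorem file (no definitions) serving the lead's skeleton `work/TipNoBinding.lean`; leans only on
proved tree lemmas (`sum_box_inv_norm_sq_le`, `mem_box`, `Site.norm_eq_supNorm`,
`Site.exists_natAbs_eq_supNorm`) and Mathlib's `ZMod.valMinAbs` API.
-/

namespace Summit.QuantumFields.QCD.Cruxes.TipNoBinding.PositivityNoLeakSpread

open Literature.MathematicalPhysics Literature.MathematicalPhysics.QuantumLattice
  Literature.MathematicalPhysics.QuantumFieldTheory Literature.Probability.LatticeModels
open Matrix

/-- `cos(2π a.val / L) = cos(2π m / L)` for the centred representative `m = valMinAbs a`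
(`a.val = m` or `a.val = m + L`). -/
private theorem greenBound_cos_two_pi_val_div (L : ℕ) [NeZero L] (a : ZMod L) :
    Real.cos (2 * Real.pi * (a.val : ℝ) / L) = Real.cos (2 * Real.pi / L * (a.valMinAbs : ℝ)) := by
  have hL : (L : ℝ) ≠ 0 := by exact_mod_cast NeZero.ne L
  have hv := ZMod.val_eq_ite_valMinAbs a
  split_ifs at hv with hc
  · have hv2 : (a.val : ℤ) = a.valMinAbs := by simpa using hv
    have hv' : (a.val : ℝ) = (a.valMinAbs : ℝ) := by exact_mod_cast hv2
    rw [hv']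
    ring_nf
  · have hv' : (a.val : ℝ) = (a.valMinAbs : ℝ) + L := by exact_mod_cast hv
    rw [hv', show 2 * Real.pi * ((a.valMinAbs : ℝ) + L) / L =
      2 * Real.pi / L * (a.valMinAbs : ℝ) + 2 * Real.pi by field_simp, Real.cos_add_two_pi]

/-- **Jordan's bound per coordinate**: `16 m² / L² ≤ 4 sin²(π a.val / L)`, `m = valMinAbs a`,
because `4 sin²(π a.val / L) = 2(1 − cos(2π m / L))`, `|2π m / L| ≤ π` and
`cos x ≤ 1 − (2/π²) x²` there. -/
private theorem greenBound_coord (L : ℕ) [NeZero L] (a : ZMod L) :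
    16 * (a.valMinAbs : ℝ) ^ 2 / (L : ℝ) ^ 2 ≤ 4 * Real.sin (Real.pi * (a.val : ℝ) / L) ^ 2 := by
  have hL : (0 : ℝ) < L := by exact_mod_cast Nat.pos_of_ne_zero (NeZero.ne L)
  have h1 : 4 * Real.sin (Real.pi * (a.val : ℝ) / L) ^ 2 =
      2 * (1 - Real.cos (2 * Real.pi / L * (a.valMinAbs : ℝ))) := by
    rw [Real.sin_sq_eq_half_sub, show 2 * (Real.pi * (a.val : ℝ) / L) =
      2 * Real.pi * (a.val : ℝ) / L by ring, greenBound_cos_two_pi_val_div]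
    ring
  -- `|2π m / L| ≤ π`
  have hb := ZMod.valMinAbs_mem_Ioc a
  have hlo : -(L : ℝ) < 2 * (a.valMinAbs : ℝ) := by
    have h : (-(L : ℤ) : ℝ) < ((a.valMinAbs * 2 : ℤ) : ℝ) := by exact_mod_cast hb.1
    push_cast at h
    linarith
  have hhi : 2 * (a.valMinAbs : ℝ) ≤ L := by
    have h : ((a.valMinAbs * 2 : ℤ) : ℝ) ≤ ((L : ℤ) : ℝ) := by exact_mod_cast hb.2
    push_cast at h
    linarith
  have hθ : |2 * Real.pi / L * (a.valMinAbs : ℝ)| ≤ Real.pi := by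
    rw [abs_le]
    constructor
    · rw [div_mul_eq_mul_div, le_div_iff₀ hL]
      nlinarith [Real.pi_pos]
    · rw [div_mul_eq_mul_div, div_le_iff₀ hL]
      nlinarith [Real.pi_pos]
  have hj := Real.cos_le_one_sub_mul_cos_sq hθ
  have heq : 2 * (2 / Real.pi ^ 2 * (2 * Real.pi / L * (a.valMinAbs : ℝ)) ^ 2) =
      16 * (a.valMinAbs : ℝ) ^ 2 / (L : ℝ) ^ 2 := by
    field_simp
    ring
  rw [h1, ← heq]
  linarith

/-- `‖n‖_∞² ≤ Σ_μ n_μ²` for `n ∈ ℤ⁴` (the sup norm is attained at some coordinate). -/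
private theorem greenBound_norm_sq_le_sum (n : Literature.Probability.LatticeModels.Site 4) :
    ‖n‖ ^ 2 ≤ ∑ μ, ((n μ : ℤ) : ℝ) ^ 2 := by
  obtain ⟨i, hi⟩ :=
    Literature.Probability.LatticeModels.Site.exists_natAbs_eq_supNorm Finset.univ_nonempty n
  have hn : ‖n‖ ^ 2 = ((n i : ℤ) : ℝ) ^ 2 := by
    rw [Literature.Probability.LatticeModels.Site.norm_eq_supNorm, ← hi, Nat.cast_natAbs,
      Int.cast_abs, sq_abs]
  rw [hn]
  exact Finset.single_le_sum (f := fun μ => ((n μ : ℤ) : ℝ) ^ 2) (fun μ _ => sq_nonneg _)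
    (Finset.mem_univ i)

/-- **Termwise bound**: for `k ≠ 0`, `1/ε_L(k) ≤ (L²/16) ‖m(k)‖_∞⁻²` with `m(k)_μ = valMinAbs (k μ)`. -/
private theorem greenBound_term (L : ℕ) [NeZero L] {k : TorusSite 4 L} (hk : k ≠ 0) :
    1 / (∑ μ, 4 * Real.sin (Real.pi * ((k μ).val : ℝ) / L) ^ 2) ≤
      (L : ℝ) ^ 2 / 16 *
        (‖(fun μ => (k μ).valMinAbs : Literature.Probability.LatticeModels.Site 4)‖ ^ 2)⁻¹ := by
  have hL : (0 : ℝ) < L := by exact_mod_cast Nat.pos_of_ne_zero (NeZero.ne L)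
  set n : Literature.Probability.LatticeModels.Site 4 := fun μ => (k μ).valMinAbs with hn
  -- `n ≠ 0`
  have hn0 : n ≠ 0 := by
    intro h
    apply hk
    funext μ
    have hμ : n μ = 0 := by rw [h]; rfl
    exact (ZMod.valMinAbs_eq_zero (k μ)).1 hμ
  have hnpos : 0 < ‖n‖ ^ 2 := by positivity
  -- `(16/L²) ‖n‖² ≤ ε_L(k)`
  have hε : 16 / (L : ℝ) ^ 2 * ‖n‖ ^ 2 ≤ ∑ μ, 4 * Real.sin (Real.pi * ((k μ).val : ℝ) / L) ^ 2 :=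
    calc 16 / (L : ℝ) ^ 2 * ‖n‖ ^ 2 ≤ 16 / (L : ℝ) ^ 2 * ∑ μ, ((n μ : ℤ) : ℝ) ^ 2 := by
          gcongr
          exact greenBound_norm_sq_le_sum n
      _ = ∑ μ, 16 * (((k μ).valMinAbs : ℤ) : ℝ) ^ 2 / (L : ℝ) ^ 2 := by
          rw [Finset.mul_sum]
          refine Finset.sum_congr rfl fun μ _ => ?_
          rw [hn]
          ring
      _ ≤ ∑ μ, 4 * Real.sin (Real.pi * ((k μ).val : ℝ) / L) ^ 2 :=
          Finset.sum_le_sum fun μ _ => greenBound_coord L (k μ)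
  have hpos : 0 < 16 / (L : ℝ) ^ 2 * ‖n‖ ^ 2 := by positivity
  calc 1 / (∑ μ, 4 * Real.sin (Real.pi * ((k μ).val : ℝ) / L) ^ 2)
      ≤ 1 / (16 / (L : ℝ) ^ 2 * ‖n‖ ^ 2) := one_div_le_one_div_of_le hpos hε
    _ = (L : ℝ) ^ 2 / 16 * (‖n‖ ^ 2)⁻¹ := by
          field_simp

/-- **THE `d = 4` CONSTANT** (registered stub `stub_greenBound` of line `positivity-no-leak-spread`):
`sup_L K_L < ∞` for the massless four-torus Green function at coinciding points,
`K_L = L⁻⁴ Σ_{k ≠ 0} 1/ε_L(k)`, `ε_L(k) = Σ_μ 4 sin²(π k_μ.val / L)`; in fact `K_L ≤ 4`.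
Jordan per coordinate (`greenBound_coord`), injectivity of the centred representatives
`k ↦ (valMinAbs (k μ))_μ` into the punctured box `{0 < ‖m‖_∞ ≤ L/2}`, and the shell count
`sum_box_inv_norm_sq_le` with `d = 4`. -/
theorem stub_greenBound :
    ∃ K : ℝ, ∀ (L : ℕ) [NeZero L],
      (1 / (L : ℝ) ^ 4) * ∑ k ∈ (Finset.univ : Finset (TorusSite 4 L)).filter (· ≠ 0),
          1 / (∑ μ, 4 * Real.sin (Real.pi * ((k μ).val : ℝ) / L) ^ 2) ≤ K := by
  refine ⟨4, fun L _ => ?_⟩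
  have hL : (0 : ℝ) < L := by exact_mod_cast Nat.pos_of_ne_zero (NeZero.ne L)
  -- the centred representatives
  set m : TorusSite 4 L → Literature.Probability.LatticeModels.Site 4 :=
    fun k μ => (k μ).valMinAbs with hm
  set s : Finset (TorusSite 4 L) := (Finset.univ : Finset (TorusSite 4 L)).filter (· ≠ 0) with hs
  have hinj : Set.InjOn m ↑s := by
    intro k _ k' _ hkk'
    funext μ
    have h : m k μ = m k' μ := by rw [hkk']
    exact ZMod.injective_valMinAbs h
  -- the image lies in the punctured box of radius `L/2`
  have hsub : s.image m ⊆ (box 4 (L / 2)).erase 0 := by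
    intro n hn
    rw [Finset.mem_image] at hn
    obtain ⟨k, hk, rfl⟩ := hn
    rw [hs, Finset.mem_filter] at hk
    rw [Finset.mem_erase]
    constructor
    · intro h
      apply hk.2
      funext μ
      have hμ : m k μ = 0 := by rw [h]; rfl
      exact (ZMod.valMinAbs_eq_zero (k μ)).1 hμ
    · rw [mem_box]
      intro μ
      have h := ZMod.natAbs_valMinAbs_le (k μ)
      change -((L / 2 : ℕ) : ℤ) ≤ (k μ).valMinAbs ∧ (k μ).valMinAbs ≤ ((L / 2 : ℕ) : ℤ)
      omega
  -- termwise Jordan bound, then reindex by the injective map `m`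
  have h1 : ∑ k ∈ s, 1 / (∑ μ, 4 * Real.sin (Real.pi * ((k μ).val : ℝ) / L) ^ 2) ≤
      ∑ k ∈ s, (L : ℝ) ^ 2 / 16 * (‖m k‖ ^ 2)⁻¹ := by
    refine Finset.sum_le_sum fun k hk => ?_
    rw [hs, Finset.mem_filter] at hk
    exact greenBound_term L hk.2
  have h2 : ∑ k ∈ s, (L : ℝ) ^ 2 / 16 * (‖m k‖ ^ 2)⁻¹ =
      (L : ℝ) ^ 2 / 16 * ∑ n ∈ s.image m, (‖n‖ ^ 2)⁻¹ := by
    rw [Finset.sum_image hinj, Finset.mul_sum]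
  have h3 : ∑ n ∈ s.image m, (‖n‖ ^ 2)⁻¹ ≤ ∑ n ∈ (box 4 (L / 2)).erase 0, (‖n‖ ^ 2)⁻¹ :=
    Finset.sum_le_sum_of_subset_of_nonneg hsub fun n _ _ => by positivity
  -- the shell count in `d = 4`
  have h4 : ∑ n ∈ (box 4 (L / 2)).erase 0, (‖n‖ ^ 2)⁻¹ ≤ 216 * ((L / 2 : ℕ) : ℝ) ^ 2 := by
    have h := sum_box_inv_norm_sq_le 4 (by norm_num) (L / 2)
    norm_num at h
    exact h
  have hR : ((L / 2 : ℕ) : ℝ) ≤ (L : ℝ) / 2 := Nat.cast_div_le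
  calc 1 / (L : ℝ) ^ 4 * ∑ k ∈ s, 1 / (∑ μ, 4 * Real.sin (Real.pi * ((k μ).val : ℝ) / L) ^ 2)
      ≤ 1 / (L : ℝ) ^ 4 * ((L : ℝ) ^ 2 / 16 * (216 * ((L : ℝ) / 2) ^ 2)) := by
        rw [h2] at h1
        gcongr
        refine h1.trans ?_
        gcongr
        exact h3.trans (h4.trans (by gcongr))
    _ = 27 / 8 := by
        field_simp
        ring
    _ ≤ 4 := by norm_num

end Summit.QuantumFields.QCD.Cruxes.TipNoBinding.PositivityNoLeakSpread
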